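import Literature.NumberTheory.ComplexMultiplication.CMOrderOverorderPicardClasses
import Literature.NumberTheory.ComplexMultiplication.CMOrderBassClifford
import HarnessLib

/-!
# Gorenstein over-orders: the list of equivalent characterisations (Buchmann–Lenstra Prop. 2.7, Marseglia
# Prop. 2.10 / §4 / Thm. 4.6, Shimura Prop. 17) as one `List.TFAE`

Layer A3 of the Hodge/CM programme (docs/m5/MAPPING.md §1), junction file of the "arbitrary order" series.  For an
over-order `S = endOrder (M_ν)` of `𝔯 = endOrder (M_μ)`, presented by its idempotent `M = MM ≠ 0` (`↑M = S`) and its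
trace dual `T` (`↑T = Mᵗ`), the following are EQUIVALENT (`overorder_gorenstein_tfae`):

1. `S` is GORENSTEIN: `(M:(M:I)) = I` for every `M`-ideal `I ≠ 0` [BuchmannLenstra1994, §2.6];
2. `Mᵗ` is invertible in `M`: `Mᵗ·(M:Mᵗ) = M` [BuchmannLenstra1994, Prop. 2.7 (c); Marseglia2019, Prop. 2.10 (c)];
3. for every `M`-ideal `I ≠ 0`: `(I:I) = M ⟺ I·(M:I) = M` [BuchmannLenstra1994, Prop. 2.7 (b); Marseglia2019, Prop. 2.10 (b)];
4. every ideal with multiplicator ring `S` is invertible in `S` («`ICM_S = Pic(S)`») [Marseglia2019, §3–§4];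
5. `#W̄k(S) = 1` [Marseglia2019, §4 remark after Def. 4.2];
6. `#ICM_S(𝔯) = #Pic(S)` (inside `ICM(𝔯)`) [Marseglia2019, Thm. 4.6];
7. `#ICM_S(𝔯) = #ClassGroup S` [Marseglia2019, Thm. 4.6 + `CMOrderOverorderPicardClasses`];
8. the `K`-isomorphism classes of the CM tori of type `(K, Φ)` with `ι(𝔯) ⊆ End` and endomorphism order EXACTLY `S`
   number `#ClassGroup S` [Shimura1998, §7.4 Prop. 17 for `S = 𝓞_K`; `CMTorusIsomorphismClassesExactOrderCount`].

`gorenstein_tfae` is the case `S = 𝔯` (`M = 1`), with (1)–(3) in the absolute forms `(𝔯:(𝔯:I)) = I`, `𝔯ᵗ` invertible,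
«`(I:I) = 𝔯` iff `I` invertible» of `CMOrderGorenstein`.  All implications are the tree's; this file only assembles
them.  Theorems only (no new definitions, no named facts).

## References
* [BuchmannLenstra1994] J. A. Buchmann, H. W. Lenstra Jr., *Approximating rings of integers in number fields*,
  JTNB 6 (1994) — §2.5–2.7, pp. 229–230.
* [Marseglia2019] S. Marseglia, *Computing the ideal class monoid of an order*, J. Lond. Math. Soc. 101 (2020),
  arXiv:1805.09671 — §2 Prop. 2.10 p. 5; §3 Prop. 3.7 p. 6; §4 Def. 4.2, Thm. 4.6 pp. 8–9.
* [Shimura1998] G. Shimura, *Abelian varieties with complex multiplication and modular functions*, PUP 1998 —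
  §7.4 Prop. 17, p. 58.
-/

noncomputable section

open scoped Classical nonZeroDivisors NumberField Pointwise
open NumberField Module FractionalIdeal

namespace Literature.NumberTheory.ComplexMultiplication

open Literature.AlgebraicGeometry.Motives (CMType)
open Literature.AlgebraicGeometry.ComplexMultiplication (CMTorus.periodEquiv)
open Literature.Geometry.Kaehler
open Literature.Geometry.Kaehler.ComplexTorus (mapMatrix)

namespace CMTypeLattice

section Gorenstein

variable {K : Type} [Field K] [NumberField K]
variable {ι : Type} [Fintype ι] [DecidableEq ι] (μ ν : Basis ι ℚ K)
variable [IsFractionRing (endOrder (Algebra.leftMulMatrix μ)) K]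

/-- **GORENSTEIN OVER-ORDERS — the equivalent characterisations** (see the module docstring for the numbered list;
`S = endOrder (M_ν) ⊇ 𝔯`, `M = MM ≠ 0` with `↑M = S`, `↑T = Mᵗ`). [cite: BuchmannLenstra1994, §2 Prop. 2.7, p. 230]
[cite: Marseglia2019, §2 Prop. 2.10, p. 5; §4 Def. 4.2 remark and Thm. 4.6, pp. 8–9] [cite: Shimura1998, §7.4 Prop. 17, p. 58] -/
theorem overorder_gorenstein_tfae (Φ : CMType K)
    (hle : endOrder (Algebra.leftMulMatrix μ) ≤ endOrder (Algebra.leftMulMatrix ν))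
    {M T : FractionalIdeal (endOrder (Algebra.leftMulMatrix μ))⁰ K} (hMM : M * M = M) (hM0 : M ≠ 0)
    (hMS : (M : Set K) = (endOrder (Algebra.leftMulMatrix ν) : Set K))
    (hT : (T : Submodule (endOrder (Algebra.leftMulMatrix μ)) K) =
      Submodule.traceDual ℤ ℚ (M : Submodule (endOrder (Algebra.leftMulMatrix μ)) K)) :
    List.TFAE [
      ∀ I : FractionalIdeal (endOrder (Algebra.leftMulMatrix μ))⁰ K, I ≠ 0 → M * I = I → M / (M / I) = I,
      T * (M / T) = M,
      ∀ I : FractionalIdeal (endOrder (Algebra.leftMulMatrix μ))⁰ K, I ≠ 0 → M * I = I → (I / I = M ↔ I * (M / I) = M),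
      ∀ I : FractionalIdeal (endOrder (Algebra.leftMulMatrix μ))⁰ K, I ≠ 0 →
        ((I / I : FractionalIdeal (endOrder (Algebra.leftMulMatrix μ))⁰ K) : Set K) =
          (endOrder (Algebra.leftMulMatrix ν) : Set K) → I * (I / I / I) = I / I,
      Nat.card (Quot fun I N : {I : FractionalIdeal (endOrder (Algebra.leftMulMatrix μ))⁰ K //
          I ≠ 0 ∧ ((I / I : FractionalIdeal (endOrder (Algebra.leftMulMatrix μ))⁰ K) : Set K) =
            (endOrder (Algebra.leftMulMatrix ν) : Set K)} =>
        (1 : K) ∈ (I : FractionalIdeal (endOrder (Algebra.leftMulMatrix μ))⁰ K) / N * (N / I)) = 1,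
      Nat.card (Quot fun I N : {I : FractionalIdeal (endOrder (Algebra.leftMulMatrix μ))⁰ K //
          I ≠ 0 ∧ ((I / I : FractionalIdeal (endOrder (Algebra.leftMulMatrix μ))⁰ K) : Set K) =
            (endOrder (Algebra.leftMulMatrix ν) : Set K)} =>
        ∃ x : K, x ≠ 0 ∧ (I : FractionalIdeal (endOrder (Algebra.leftMulMatrix μ))⁰ K) =
          spanSingleton (endOrder (Algebra.leftMulMatrix μ))⁰ x * N) =
      Nat.card (Quot fun L N : {L : FractionalIdeal (endOrder (Algebra.leftMulMatrix μ))⁰ K //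
          (L ≠ 0 ∧ ((L / L : FractionalIdeal (endOrder (Algebra.leftMulMatrix μ))⁰ K) : Set K) =
            (endOrder (Algebra.leftMulMatrix ν) : Set K)) ∧ L * (L / L / L) = L / L} =>
        ∃ x : K, x ≠ 0 ∧ (L : FractionalIdeal (endOrder (Algebra.leftMulMatrix μ))⁰ K) =
          spanSingleton (endOrder (Algebra.leftMulMatrix μ))⁰ x * N),
      Nat.card (Quot fun I N : {I : FractionalIdeal (endOrder (Algebra.leftMulMatrix μ))⁰ K //
          I ≠ 0 ∧ ((I / I : FractionalIdeal (endOrder (Algebra.leftMulMatrix μ))⁰ K) : Set K) =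
            (endOrder (Algebra.leftMulMatrix ν) : Set K)} =>
        ∃ x : K, x ≠ 0 ∧ (I : FractionalIdeal (endOrder (Algebra.leftMulMatrix μ))⁰ K) =
          spanSingleton (endOrder (Algebra.leftMulMatrix μ))⁰ x * N) =
      Nat.card (ClassGroup (endOrder (Algebra.leftMulMatrix ν))),
      Nat.card (Quot fun μ' μ'' : {μ' : Basis ι ℚ K //
          endOrder (Algebra.leftMulMatrix μ) ≤ endOrder (Algebra.leftMulMatrix μ') ∧
            endOrder (Algebra.leftMulMatrix μ') = endOrder (Algebra.leftMulMatrix ν)} =>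
        ∃ A : Matrix ι ι ℤ,
          Function.Bijective
              (mapMatrix (CMTorus.periodEquiv Φ (μ' : Basis ι ℚ K)) (CMTorus.periodEquiv Φ (μ'' : Basis ι ℚ K)) A) ∧
            ∀ α : K, A.map (Int.cast : ℤ → ℚ) * Algebra.leftMulMatrix (μ' : Basis ι ℚ K) α =
              Algebra.leftMulMatrix (μ'' : Basis ι ℚ K) α * A.map (Int.cast : ℤ → ℚ)) =
      Nat.card (ClassGroup (endOrder (Algebra.leftMulMatrix ν)))] := by
  haveI : Nonempty ι := μ.index_nonempty
  have hT0 : T ≠ 0 := by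
    obtain ⟨T', hT'0, hT'⟩ := exists_coe_eq_traceDual μ hM0
    rwa [← coeToSubmodule_inj.1 (hT'.trans hT.symm)]
  tfae_have 1 ↔ 2 := forall_div_div_eq_iff_traceDual_mul_div_eq μ hMM hM0 hT0 hT
  tfae_have 1 ↔ 3 := forall_div_div_eq_iff_forall_div_self_eq_iff_mul_div_eq μ hMM hM0
  tfae_have 1 → 4 := fun h I hI hIS => by
    have hII : I / I = M := SetLike.coe_injective (hIS.trans hMS.symm)
    have ha : ∀ N : FractionalIdeal (endOrder (Algebra.leftMulMatrix μ))⁰ K, N ≠ 0 → I / I * N = N →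
        I / I / (I / I / N) = N := by
      rw [hII]
      exact h
    exact EndOrder.mul_div_self_div_eq_div_self_of_forall_div_div_eq hI ha
  tfae_have 4 → 2 := fun h => by
    have hTT : T / T = M := traceDual_div_traceDual_eq_of_mul_self_eq μ hMM hM0 hT0 hT
    have h' := h T hT0 (by rw [hTT, hMS])
    rwa [hTT] at h'
  tfae_have 1 ↔ 5 := (natCard_quot_stratum_weak_eq_one_iff_forall_div_div_eq μ hMM hM0 hMS).symm
  tfae_have 1 ↔ 6 := (natCard_quot_stratum_eq_natCard_quot_pic_iff_forall_div_div_eq μ hMM hM0 hMS).symm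
  tfae_have 1 ↔ 7 := (natCard_quot_stratum_eq_natCard_classGroup_iff_forall_div_div_eq μ ν hle hMM hM0 hMS).symm
  tfae_have 1 ↔ 8 :=
    (natCard_quot_exists_bijective_comm_eq_natCard_classGroup_iff_forall_div_div_eq μ ν Φ hle hMM hM0 hMS).symm
  tfae_finish

/-- **GORENSTEIN ORDERS — the equivalent characterisations for the order `𝔯 = endOrder (M_μ)` itself**
(`↑T = 𝔯ᵗ`): [`(𝔯:(𝔯:I)) = I` for all `I ≠ 0` · `𝔯ᵗ` invertible · «`(I:I) = 𝔯` iff `I` invertible» for all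
`I ≠ 0` · `#W̄k(𝔯) = 1` · `#ICM_𝔯(𝔯) = #Pic(𝔯) = #ClassGroup 𝔯` · the CM tori of type `(K, Φ)` with endomorphism
order EXACTLY `𝔯` number `#ClassGroup 𝔯`]. [cite: BuchmannLenstra1994, §2 Prop. 2.7, p. 230]
[cite: Marseglia2019, §2 Prop. 2.10, p. 5; §4, pp. 8–9] [cite: Shimura1998, §7.4 Prop. 17, p. 58] -/
theorem gorenstein_tfae (Φ : CMType K) {T : FractionalIdeal (endOrder (Algebra.leftMulMatrix μ))⁰ K}
    (hT : (T : Submodule (endOrder (Algebra.leftMulMatrix μ)) K) =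
      Submodule.traceDual ℤ ℚ ((1 : FractionalIdeal (endOrder (Algebra.leftMulMatrix μ))⁰ K) :
        Submodule (endOrder (Algebra.leftMulMatrix μ)) K)) :
    List.TFAE [
      ∀ I : FractionalIdeal (endOrder (Algebra.leftMulMatrix μ))⁰ K, I ≠ 0 → 1 / (1 / I) = I,
      IsUnit T,
      ∀ I : FractionalIdeal (endOrder (Algebra.leftMulMatrix μ))⁰ K, I ≠ 0 → (IsUnit I ↔ I / I = 1),
      Nat.card (Quot fun I N : {I : FractionalIdeal (endOrder (Algebra.leftMulMatrix μ))⁰ K //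
          I ≠ 0 ∧ ((I / I : FractionalIdeal (endOrder (Algebra.leftMulMatrix μ))⁰ K) : Set K) =
            (endOrder (Algebra.leftMulMatrix μ) : Set K)} =>
        (1 : K) ∈ (I : FractionalIdeal (endOrder (Algebra.leftMulMatrix μ))⁰ K) / N * (N / I)) = 1,
      Nat.card (Quot fun I N : {I : FractionalIdeal (endOrder (Algebra.leftMulMatrix μ))⁰ K //
          I ≠ 0 ∧ ((I / I : FractionalIdeal (endOrder (Algebra.leftMulMatrix μ))⁰ K) : Set K) =
            (endOrder (Algebra.leftMulMatrix μ) : Set K)} =>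
        ∃ x : K, x ≠ 0 ∧ (I : FractionalIdeal (endOrder (Algebra.leftMulMatrix μ))⁰ K) =
          spanSingleton (endOrder (Algebra.leftMulMatrix μ))⁰ x * N) =
      Nat.card (ClassGroup (endOrder (Algebra.leftMulMatrix μ))),
      Nat.card (Quot fun μ' μ'' : {μ' : Basis ι ℚ K //
          endOrder (Algebra.leftMulMatrix μ) ≤ endOrder (Algebra.leftMulMatrix μ') ∧
            endOrder (Algebra.leftMulMatrix μ') = endOrder (Algebra.leftMulMatrix μ)} =>
        ∃ A : Matrix ι ι ℤ,
          Function.Bijective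
              (mapMatrix (CMTorus.periodEquiv Φ (μ' : Basis ι ℚ K)) (CMTorus.periodEquiv Φ (μ'' : Basis ι ℚ K)) A) ∧
            ∀ α : K, A.map (Int.cast : ℤ → ℚ) * Algebra.leftMulMatrix (μ' : Basis ι ℚ K) α =
              Algebra.leftMulMatrix (μ'' : Basis ι ℚ K) α * A.map (Int.cast : ℤ → ℚ)) =
      Nat.card (ClassGroup (endOrder (Algebra.leftMulMatrix μ)))] := by
  haveI : Nonempty ι := μ.index_nonempty
  have h1 : (1 : FractionalIdeal (endOrder (Algebra.leftMulMatrix μ))⁰ K) ≠ 0 :=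
    one_ne_zero' (FractionalIdeal (endOrder (Algebra.leftMulMatrix μ))⁰ K)
  have hMS := coe_one_eq_coe_endOrder μ
  -- the relative form `∀ I ≠ 0, 1·I = I → (1:(1:I)) = I` of (1)
  have hrel : (∀ I : FractionalIdeal (endOrder (Algebra.leftMulMatrix μ))⁰ K, I ≠ 0 → 1 * I = I → 1 / (1 / I) = I) ↔
      ∀ I : FractionalIdeal (endOrder (Algebra.leftMulMatrix μ))⁰ K, I ≠ 0 → 1 / (1 / I) = I :=
    ⟨fun h I hI => h I hI (one_mul I), fun h I hI _ => h I hI⟩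
  tfae_have 1 ↔ 2 := forall_one_div_one_div_eq_iff_isUnit_traceDual μ hT
  tfae_have 1 ↔ 3 := forall_one_div_one_div_eq_iff_forall_isUnit_iff_div_self_eq_one μ
  tfae_have 1 ↔ 4 := by
    rw [← hrel]
    exact (natCard_quot_stratum_weak_eq_one_iff_forall_div_div_eq μ (one_mul 1) h1 hMS).symm
  tfae_have 1 ↔ 5 := by
    rw [← hrel]
    exact (natCard_quot_stratum_eq_natCard_classGroup_iff_forall_div_div_eq μ μ le_rfl (one_mul 1) h1 hMS).symm
  tfae_have 1 ↔ 6 := by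
    rw [← hrel]
    exact (natCard_quot_exists_bijective_comm_eq_natCard_classGroup_iff_forall_div_div_eq μ μ Φ le_rfl
      (one_mul 1) h1 hMS).symm
  tfae_finish

end Gorenstein

end CMTypeLattice

end Literature.NumberTheory.ComplexMultiplication
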